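/-
COR-CM (cell pub-hodgecm2, stage 2 of the Hodge ladder) — count-neutral kernel combinatorics (seat prover-pub-hodgecm2-b23-g51-0, binder
prover b23, gen 51; lane SYLOW TRANSFER, claim HOME/INBOX.md l.23329; blanket `Census/SylowTransfer*` l.23357).  Pure group theory plus parts I/IV;
theorems only (no definition, no certificate, no `decide`, no named fact, no `sorry`).
`Interfaces.lean` (C1), every E term, B01 and `Transposition/*` are untouched.
HONEST FRAMING: `HC_CM` is NOT proved, here or anywhere in the tree; nothing here is a period or a headline.
-/
import Summits.HodgeConjecture.CorCM.Census.SylowTransferAbelian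
import Summits.HodgeConjecture.CorCM.Census.IndexTwoCyclicOrderEight

/-!
# Sylow transfer, XI: the square criterion — for `16 ∤ |G|`, `c` is complemented iff `c` is not a square

Seat b23 gen 39 (`CorCM/FaceAbelianImaginaryQuadratic.lean`) proved for ABELIAN Galois groups: complex conjugation is complemented (⟺ the field
contains an imaginary quadratic field) iff it is not a square.  Part I localised complements at the Sylow `2`-subgroup `P` (`c ∉ Φ(P)`); THIS FILE
removes the commutativity for all groups whose order is not divisible by `16` (`|P| ≤ 8`, where `Φ(P)` is the set of squares):
* §1 `exists_sq_mem_sylow_of_sq` — a central `c = g²` is a square INSIDE every Sylow `2`-subgroup (Sylow conjugacy);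
  `exists_sq_of_card_eight_not_comm` — in a NON-abelian subgroup of order `8` a central involution is a square (`Z(P) = {1, c}`, `P/Z(P)` has exponent
  two, so every square lies in `Z(P)`, and not every square is `1`; no classification); `comm_of_card_dvd_four`.
* §2 **`exists_cpl_iff_not_sq`**: for `16 ∤ |G|` and a central involution `c ≠ 1`: `c` is complemented ⟺ `c` is not a square in `G`
  (⟹ always: a square lies in every index-two subgroup; ⟸: abelian `P` by part IV, non-abelian `P` of order `8` impossible by §1);
  the law **`isLeast_card_gfaces_generate_fibreTwo_of_not_sq`** (`μ = φ₂`, block currency `β − 1 − δ`, for non-square `c`, `16 ∤ |G|`).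
The field form («a Galois CM field of degree not divisible by `16` contains an imaginary quadratic field iff complex conjugation is not the square
of an automorphism») is `CorCM/FaceSylowTransferSquare.lean`.
All [folklore].

## References
* [Pohlmann1968] H. Pohlmann, Algebraic cycles on abelian varieties of complex multiplication type, Ann. of Math. 88 (1968), Thm 1.
* [Milne1999] J. S. Milne, Lefschetz motives and the Tate conjecture, Compositio Math. 117 (1999), Prop. 2.1, p. 54.
-/

namespace Summit.HodgeConjecture.CorCM.Census.SylowTransfer

open Finset
open Summit.HodgeConjecture.CorCM.Prior.AllgGroup.RfwfAllgGroup
open Summit.HodgeConjecture.CorCM.Census.BlockParity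
open Summit.HodgeConjecture.CorCM.Census.Coinvariant
open Summit.HodgeConjecture.CorCM.Census.ComplementFaces

noncomputable section

variable {G : Type*} [Group G] [Fintype G] [DecidableEq G] (c : G)

/-! ## §1 Squares and Sylow `2`-subgroups -/

omit [DecidableEq G] in
/-- **A central square root descends to every Sylow `2`-subgroup**: if `g² = c` with `c` a central involution, then `c = y²` for some `y ∈ P`.
[folklore] -/
theorem exists_sq_mem_sylow_of_sq (P : Sylow 2 G) (hc2 : c * c = 1) (hcen : ∀ x : G, x * c = c * x) {g : G} (hg : g * g = c) :
    ∃ y ∈ (P : Subgroup G), y * y = c := by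
  haveI : Fact (Nat.Prime 2) := ⟨Nat.prime_two⟩
  have hg4 : g ^ 4 = 1 := by rw [show 4 = 2 * 2 by norm_num, pow_mul, pow_two g, hg, pow_two, hc2]
  have hPG : IsPGroup 2 (Subgroup.zpowers g) := by
    refine IsPGroup.iff_orderOf.mpr fun x => ?_
    have hdvd : orderOf x ∣ 2 ^ 2 := by
      rw [← Subgroup.orderOf_coe, show (2 : ℕ) ^ 2 = 4 by norm_num]
      obtain ⟨z, hz⟩ := Subgroup.mem_zpowers_iff.mp x.2
      refine orderOf_dvd_of_pow_eq_one ?_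
      rw [← hz, ← zpow_natCast, ← zpow_mul, mul_comm, zpow_mul, zpow_natCast, hg4, one_zpow]
    obtain ⟨k, -, hk⟩ := (Nat.dvd_prime_pow Nat.prime_two).mp hdvd
    exact ⟨k, hk⟩
  obtain ⟨Q, hQ⟩ := hPG.exists_le_sylow
  obtain ⟨h, hh⟩ := MulAction.exists_smul_eq G P Q
  have hgQ : g ∈ ((h • P : Sylow 2 G) : Subgroup G) := by rw [hh]; exact hQ (Subgroup.mem_zpowers g)
  rw [Sylow.coe_subgroup_smul, Subgroup.mem_smul_pointwise_iff_exists] at hgQ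
  obtain ⟨p, hp, hpg⟩ := hgQ
  rw [MulAut.smul_def, MulAut.conj_apply] at hpg
  refine ⟨p, hp, ?_⟩
  have h1 : h * (p * p) * h⁻¹ = c := by
    rw [show h * (p * p) * h⁻¹ = (h * p * h⁻¹) * (h * p * h⁻¹) by group, hpg, hg]
  rw [mul_inv_eq_iff_eq_mul, ← hcen h] at h1
  exact mul_left_cancel h1

omit [Fintype G] [DecidableEq G] in
/-- A subgroup of order dividing `4` is abelian. [folklore] -/
theorem comm_of_card_dvd_four [Finite G] {P : Subgroup G} (h : Nat.card P ∣ 4) : ∀ a ∈ P, ∀ b ∈ P, a * b = b * a := by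
  haveI : Fact (Nat.Prime 2) := ⟨Nat.prime_two⟩
  obtain ⟨i, hi, hPi⟩ := (Nat.dvd_prime_pow Nat.prime_two).mp (show Nat.card P ∣ 2 ^ 2 by simpa using h)
  intro a ha b hb
  interval_cases i
  · rw [pow_zero] at hPi
    have h1 := (Subgroup.card_eq_one.mp hPi)
    rw [h1] at ha hb
    rw [Subgroup.mem_bot.mp ha, Subgroup.mem_bot.mp hb]
  · rw [pow_one] at hPi
    haveI : IsCyclic P := isCyclic_of_prime_card (p := 2) hPi
    obtain ⟨g, hg⟩ := IsCyclic.exists_generator (α := P)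
    obtain ⟨m, hm⟩ := Subgroup.mem_zpowers_iff.mp (hg ⟨a, ha⟩)
    obtain ⟨n, hn⟩ := Subgroup.mem_zpowers_iff.mp (hg ⟨b, hb⟩)
    have := (Commute.zpow_zpow_self g m n).eq
    rw [hm, hn] at this
    exact congrArg Subtype.val this
  · exact congrArg Subtype.val ((IsPGroup.isMulCommutative_of_card_eq_prime_sq hPi).is_comm.comm ⟨a, ha⟩ ⟨b, hb⟩)

omit [Fintype G] [DecidableEq G] in
/-- **In a non-abelian subgroup of order `8` a central involution is a square** (`Z(P) = {1, c}`, `P/Z(P)` is the four-group, so every square lies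
in `Z(P)`, and a group of exponent two would be abelian). [folklore] -/
theorem exists_sq_of_card_eight_not_comm [Finite G] {P : Subgroup G} (hP : Nat.card P = 8) (hnc : ¬ ∀ a ∈ P, ∀ b ∈ P, a * b = b * a)
    (hcP : c ∈ P) (hc2 : c * c = 1) (hc1 : c ≠ 1) (hcen : ∀ x : G, x * c = c * x) : ∃ y ∈ P, y * y = c := by
  classical
  haveI : Fact (Nat.Prime 2) := ⟨Nat.prime_two⟩
  set c' : P := ⟨c, hcP⟩ with hc'
  have hc'2 : c' * c' = 1 := Subtype.ext hc2
  have hc'1 : c' ≠ 1 := fun h => hc1 (congrArg Subtype.val h)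
  have hord : orderOf c' = 2 := orderOf_eq_prime (by rw [pow_two, hc'2]) hc'1
  set Z := Subgroup.center P with hZ
  have hc'Z : c' ∈ Z := Subgroup.mem_center_iff.mpr fun g => Subtype.ext (hcen g)
  have hnc' : ¬ ∀ a b : P, a * b = b * a := fun h => hnc fun a ha b hb => congrArg Subtype.val (h ⟨a, ha⟩ ⟨b, hb⟩)
  have hcyc_quot : ¬ IsCyclic (P ⧸ Z) := fun hcyc =>
    hnc' fun a b => (MonoidHom.isMulCommutative_of_isCyclic_of_ker_le_center (QuotientGroup.mk' Z)
      (by rw [QuotientGroup.ker_mk'])).is_comm.comm a b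
  have hZle : Subgroup.zpowers c' ≤ Z := (Subgroup.zpowers_le).mpr hc'Z
  have hZ2 : 2 ≤ Nat.card Z := by
    have := Subgroup.card_le_of_le hZle
    rwa [Nat.card_zpowers, hord] at this
  have hZtop : Z ≠ ⊤ := fun h => hnc' fun a b => by
    have hb : b ∈ Z := by rw [h]; exact Subgroup.mem_top b
    exact Subgroup.mem_center_iff.mp hb a
  -- `|Z| = 2`
  obtain ⟨i, hi, hZi⟩ := (Nat.dvd_prime_pow Nat.prime_two).mp
    (show Nat.card Z ∣ 2 ^ 3 by rw [show (2 : ℕ) ^ 3 = 8 by norm_num, ← hP]; exact Subgroup.card_subgroup_dvd_card Z)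
  have hquot := Subgroup.card_eq_card_quotient_mul_card_subgroup Z
  have hZcard : Nat.card Z = 2 := by
    interval_cases i
    · rw [hZi] at hZ2; norm_num at hZ2
    · rw [hZi, pow_one]
    · exfalso
      have hq : Nat.card (P ⧸ Z) = 2 := by rw [hP, hZi] at hquot; omega
      exact hcyc_quot (isCyclic_of_prime_card (p := 2) hq)
    · exact absurd (Subgroup.eq_top_of_card_eq Z (by rw [hZi, hP]; norm_num)) hZtop
  -- `Z = ⟨c'⟩`, `P/Z` has exponent two, squares lie in `Z`
  have hZeq : Subgroup.zpowers c' = Z := Subgroup.eq_of_le_of_card_ge hZle (by rw [hZcard, Nat.card_zpowers, hord])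
  haveI : Fintype (P ⧸ Z) := Fintype.ofFinite _
  have hq4 : Fintype.card (P ⧸ Z) = 4 := by
    rw [hP, hZcard, Nat.card_eq_fintype_card] at hquot
    omega
  have hsqZ : ∀ k : P, k * k ∈ Z := fun k => by
    rw [← QuotientGroup.eq_one_iff, QuotientGroup.mk_mul]
    exact IndexTwoCyclic.forall_mul_self_of_card_eq_four hq4 hcyc_quot _
  -- some square is not `1`
  obtain ⟨k, hk⟩ : ∃ k : P, k * k ≠ 1 := by
    by_contra h
    push Not at h
    have hinv : ∀ x : P, x⁻¹ = x := fun x => inv_eq_of_mul_eq_one_right (h x)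
    exact hnc' fun a b => by
      calc a * b = (a * b)⁻¹ := (hinv _).symm
        _ = b⁻¹ * a⁻¹ := mul_inv_rev _ _
        _ = b * a := by rw [hinv, hinv]
  have hmem : k * k ∈ Subgroup.zpowers c' := by rw [hZeq]; exact hsqZ k
  rw [mem_zpowers_iff_mem_range_orderOf, hord, Finset.mem_image] at hmem
  obtain ⟨j, hj, hjk⟩ := hmem
  have hj2 : j < 2 := Finset.mem_range.mp hj
  interval_cases j
  · rw [pow_zero] at hjk
    exact absurd hjk.symm hk
  · rw [pow_one] at hjk
    exact ⟨k, k.2, by have := congrArg Subtype.val hjk; exact this.symm⟩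

/-! ## §2 The square criterion for `16 ∤ |G|` -/

omit [Fintype G] [DecidableEq G] in
/-- **A complemented central involution is not a square** (a square lies in every index-two subgroup). [folklore] -/
theorem not_sq_of_cpl (hc2 : c * c = 1) (hcen : ∀ x : G, x * c = c * x) {A : Subgroup G} (hA : ∀ x : G, x ∈ A ↔ c * x ∉ A) :
    ¬ ∃ g : G, g * g = c := by
  rintro ⟨g, hg⟩
  exact self_notMem_cpl c hc2 hA (hg ▸ Subgroup.mul_self_mem_of_index_two (index_eq_two_of_cpl c hcen hA) g)

omit [DecidableEq G] in
/-- For `16 ∤ |G|` a Sylow `2`-subgroup has order dividing `8`. [folklore] -/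
theorem card_sylow_dvd_eight (h16 : ¬ 16 ∣ Fintype.card G) (P : Sylow 2 G) : Nat.card (P : Subgroup G) ∣ 8 := by
  haveI : Fact (Nat.Prime 2) := ⟨Nat.prime_two⟩
  obtain ⟨n, hn⟩ := P.2.exists_card_eq
  have hdvd : 2 ^ n ∣ Fintype.card G := by rw [← hn, ← Nat.card_eq_fintype_card]; exact Subgroup.card_subgroup_dvd_card _
  have hn3 : n ≤ 3 := by
    by_contra hn3
    exact h16 ((pow_dvd_pow 2 (show 4 ≤ n by omega)).trans hdvd)
  rw [hn, show (8 : ℕ) = 2 ^ 3 by norm_num]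
  exact pow_dvd_pow 2 hn3

omit [DecidableEq G] in
/-- **THE SQUARE CRITERION**: for `16 ∤ |G|` and a central involution `c ≠ 1`, `c` is complemented iff `c` is not a square in `G`. [folklore] -/
theorem exists_cpl_iff_not_sq (h16 : ¬ 16 ∣ Fintype.card G) (hc2 : c * c = 1) (hc1 : c ≠ 1) (hcen : ∀ x : G, x * c = c * x) :
    (∃ A : Subgroup G, ∀ x : G, x ∈ A ↔ c * x ∉ A) ↔ ¬ ∃ g : G, g * g = c := by
  haveI : Fact (Nat.Prime 2) := ⟨Nat.prime_two⟩
  constructor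
  · rintro ⟨A, hA⟩
    exact not_sq_of_cpl c hc2 hcen hA
  · intro hns
    obtain ⟨P⟩ := (inferInstance : Nonempty (Sylow 2 G))
    by_cases hcomm : ∀ a ∈ (P : Subgroup G), ∀ b ∈ (P : Subgroup G), a * b = b * a
    · exact exists_cpl_of_sylow_comm_not_sq c P hcomm (fun y hy h => hns ⟨y, h⟩) hc2 hcen
    · exfalso
      have h8 : Nat.card (P : Subgroup G) = 8 := by
        obtain ⟨i, hi, hPi⟩ := (Nat.dvd_prime_pow Nat.prime_two).mp
          (show Nat.card (P : Subgroup G) ∣ 2 ^ 3 by simpa using card_sylow_dvd_eight h16 P)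
        have hi3 : ¬ i ≤ 2 := fun hi2 => hcomm (comm_of_card_dvd_four (by rw [hPi, show (4 : ℕ) = 2 ^ 2 by norm_num]; exact pow_dvd_pow 2 hi2))
        rw [hPi, show i = 3 by omega]; norm_num
      obtain ⟨y, -, hy⟩ := exists_sq_of_card_eight_not_comm c h8 hcomm (TypeStabiliser.mem_sylow_of_central c hc2 hcen P) hc2 hc1 hcen
      exact hns ⟨y, hy⟩

/-- **`16 ∤ |G|`, `c` NOT A SQUARE ⟹ `μ(G, c) = φ₂(G, c)`** (complemented; gen 40ʼs law BY NAME). [folklore] -/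
theorem isLeast_card_gfaces_generate_fibreTwo_of_not_sq (h16 : ¬ 16 ∣ Fintype.card G) (hns : ∀ g : G, g * g ≠ c)
    (hc2 : c * c = 1) (hc1 : c ≠ 1) (hcen : ∀ x : G, x * c = c * x) :
    IsLeast {m : ℕ | ∃ S : Finset (CMF G c →₀ ℤ), (↑S ⊆ gfaceSet G c hc2) ∧ S.card = m ∧
      hodgeSpan c hc2 ≤ Submodule.span ℤ (pairSet c) ⊔ Submodule.span ℤ (translates c S)} (fibreTwo c hc2) := by
  obtain ⟨A, hA⟩ := (exists_cpl_iff_not_sq c h16 hc2 hc1 hcen).mpr (fun ⟨g, hg⟩ => hns g hg)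
  exact isLeast_card_gfaces_generate_fibreTwo_of_cpl c hA hc2 hc1 hcen

/-- Block currency: `16 ∤ |G|`, `c` not a square ⟹ `μ(G, c) = β(G, c) − 1 − δ`. [folklore] -/
theorem isLeast_card_gfaces_generate_of_not_sq (h16 : ¬ 16 ∣ Fintype.card G) (hns : ∀ g : G, g * g ≠ c)
    (hc2 : c * c = 1) (hc1 : c ≠ 1) (hcen : ∀ x : G, x * c = c * x) (T₀ : CMF G c) :
    IsLeast {m : ℕ | ∃ S : Finset (CMF G c →₀ ℤ), (↑S ⊆ gfaceSet G c hc2) ∧ S.card = m ∧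
      hodgeSpan c hc2 ≤ Submodule.span ℤ (pairSet c) ⊔ Submodule.span ℤ (translates c S)}
      (Fintype.card (Block c) - 1 - wdelta c T₀) := by
  obtain ⟨A, hA⟩ := (exists_cpl_iff_not_sq c h16 hc2 hc1 hcen).mpr (fun ⟨g, hg⟩ => hns g hg)
  exact isLeast_card_gfaces_generate_of_cpl c hA hc2 hc1 hcen T₀

end

end Summit.HodgeConjecture.CorCM.Census.SylowTransfer
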